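import Summits.QuantumFields.YangMills.Theorems.BalabanUVNodesK2NamedJetsRemAt
import Summits.QuantumFields.YangMills.Theorems.BalabanUVNodesK1EndOfNodes13PWSOfPartialSums

/-!
# BalabanUVNodes ∕ K1⁷ — THE CRUX's β-SIDE IN K2⁷'s EDITION-3 «named jets» CURRENCY (ym-nodeO DEF-1, `BalabanUVNodesK2NamedJetsRemAt`, p593586): `StabilityBAtRecordR13SepCoPH` BY NAME
# from K1⁷'s STUB 1 and the ed.3 stub texts — `RemAt F κ θ hP θ.cβ` (constant remainder + per-scale anchor + (C); NO ceiling conjunct) and the drift of the named numbers — with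
# BOTH K1-side β letters (the partial-sum floor AND the ceiling) taken BY NAME from DEF-1's `constAnchorPackage_of_remAt_drift`

TRACK A (YM-PLAN §2d), node N24 (binder B2, COMPOSITE), WIDTH SEAT `pub-ymgap-dag-n24-w1` (director-ym №197 ∕ HUMAN RULING D-0149; plan W-SEAT-START-LIST §1 n24 ITEM 1, sixth
module — the «K1 reader» edition invited by ym-nodeO DEF-1's INTENT-2, pub-ymgap INBOX l.26072: «the ceiling now comes from `constAnchorPackage_of_remAt_drift`, shape
`stepBal 2 F.L + 2A + s`»).  Key of record: K1⁷ `StabilityBAtRecordR13SepCoPH` = stmt-QuantumFields-20542; `--supports` it AS A HELPER (count-neutral).  Companions: this seat's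
`…K1EndOfNodes13PWSOfPartialSums` (p588006: the θ-keyed consequent from `BetaPartialSumsLowerH` + `BetaUpperH`; its §1 flow lemmas RESTATE strat-b14's `B14FlowStep.flow26d_of_partialSum_ge`
∕ `flowControl_of_partialSum` — credit recorded on the bus, ERRATUM-1 l.25946) and `…K1EndOfNodes13PWSOfK2NamedJets` (p591432: the ed.2 ∕ v3 `BoxRemainder` letter, now superseded
as K2⁷'s registered text by DEF-1's edition 3).

THE POINT (edition 3).  DEF-1's letter `RemAt F κ θ hP c` = «on SOME box `]0, γ₀] ⊆ ]0, θ.γ]`: `ConstRemainder (datum).βfun (c·beta0OfJs F κ) s γ₀` with the cap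
`s ≤ c·stepBal 2 F.L`, `ScaleAnchor`, `BetaContH γ₀`» carries NO ceiling; given stub 1′'s drift `OneLoopDrift (stepBal 2 F.L) A (beta0OfJs F κ)` DEF-1's
`constAnchorPackage_of_remAt_drift` RECOVERS both K1-side letters BY NAME: `BetaPartialSumsLowerH (2|c|A) γ₀ (datum).βfun` and `BetaUpperH (c·stepBal 2 F.L + 2|c|A + s) γ₀ (datum).βfun`.
So the K1 (B)-road needs, beyond a rung-1 witness and the two ed.3 stub texts, ONLY the ceiling MATCH `c·stepBal + 2|c|A + s ≤ w.βup` — automatic for a ceiling-uniform rung-1 family,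
a displayed letter otherwise (dag-n12-d ANSWER-CEILING l.25740: exactly one rung-1 row, N11's `flowControl`, reads `w.βup`).
* §1 ★★★ `stabilityB_body_of_rung1At_of_remAtE3_of_drift` (`N = 2`, any scale `c`) — the consequent at θ from a rung-1 datum + `RemAt F κ θ h c` + the drift for κ + the ceiling
  letter `BetaUpperH w.βup γ₁ (datum).βfun` on SOME window (windows merged by `min`).
* §2 ★★★★★ `stabilityBAtRecordR13SepCoPH_of_stub1CeilingUniform_of_k2NamedJetsStubsE3` — THE ROUTE DECL BY NAME from the CEILING-UNIFORM rung-1 text and the ed.3 stub texts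
  `h₁ ∕ h₂` VERBATIM from DEF-1's `EndpointGivenBR13SepCoPH_of_shadowingJets` (scale `θ.cβ`) — NO β letter on the K1 side.
* §3 ★★★★ `stabilityBAtRecordR13SepCoPH_of_stub1_of_k2NamedJetsStubsE3_of_ceiling_at_witness` — the same from the REGISTERED rung-1 text (v5, `RecordS` unfolded) + «at every rung-1
  witness `∃ γ₁ > 0, BetaUpperH w.βup γ₁ (datum θ h).βfun`» (the ceiling-match letter).

HONEST SCOPE ∕ A6.  Implications only; the rung-1 texts, the ed.3 stub texts ((P6) — the VALUE of κ — unpinned; K2⁷ OPEN) and the ceiling match are DISPLAYED hypotheses inhabited at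
NO θ here («not exhibited», №167); whether rung-1 worlds are ceiling-uniform is the rung-1 lanes' question (dag-n11-e's `h11`), NOT claimed.  Nothing of Bałaban asserted; K1⁷ ∕ K2⁷
NOT closed; N24 COMPOSITE — no discharge, no count claim (typed 28∕28 · discharged 5∕27 unmoved).  One finite 𝕋⁴ programme at fixed ε, Bałaban AS PRINTED; R4 closes ONLY the conditional
finite-𝕋⁴ rung `BalabanLadder.UV` — the YM mass gap (Clay) is NOT proved by any of this; nothing continuum ∕ ℝ⁴ ∕ OS.  Theorems only: no `def`, no `instance`, no `sorry`, standard axioms.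
-/

noncomputable section

open scoped Matrix.Norms.L2Operator

namespace Summit.QuantumFields.YangMills.BalabanUVNodes.K1EndOfNodes13PWSOfK2NamedJetsE3

open Literature.MathematicalPhysics.QuantumFieldTheory.Balaban1983to89
open Literature.MathematicalPhysics.QuantumFieldTheory.Balaban1983to89.Node00
open DagBinding T4Continuum T4DatumAssembly FlowStepRuns
open FlowStep (HBeta BetaUpperH box_mono)
open Literature.MathematicalPhysics.QuantumFieldTheory.Balaban1983to89.Beta.Drift (OneLoopDrift)
open Summit.QuantumFields.YangMills.Theorems.BalabanUVNodesK2JsOfRecord (StepColourData beta0OfJs)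
open Summit.QuantumFields.YangMills.Theorems.BalabanUVNodesK2NamedJetsRemAt (RemAt constAnchorPackage_of_remAt_drift)
open Summit.QuantumFields.YangMills.BalabanUVNodes.K1EndOfNodes13PWSOfPartialSums (stabilityB_body_of_rung1At_of_partialSumsH_of_ceiling)

/-! ## §1. ★★★ The consequent at θ from a rung-1 datum, DEF-1's edition-3 letter at scale `c`, the drift, and the ceiling letter -/

section AtTheta

variable {F : T4Family}

/-- **★★★ THE CRUX's CONSEQUENT AT θ FROM A RUNG-1 DATUM AND THE EDITION-3 LETTERS AT θ.**  `hRem : RemAt F κ θ h c` (DEF-1's letter VERBATIM: constant remainder with cap, per-scale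
anchor, (C) — no ceiling), `hdrift` = stub 1′'s conclusion for that κ, `hhi` = the rung-1 world's ceiling letter on SOME window.  DEF-1's `constAnchorPackage_of_remAt_drift` gives the
partial-sum floor `BetaPartialSumsLowerH (2|c|A) γ₀` BY NAME; windows merged by `min` (`FlowStepRuns.betaPartialSumsLowerH_mono`, `FlowStep.box_mono`); then the companion's θ-keyed
`stabilityB_body_of_rung1At_of_partialSumsH_of_ceiling`.  CONDITIONAL; (P6) unpinned; nothing of Bałaban asserted; K1⁷ ∕ K2⁷ NOT closed.
[cite: Balaban1987RG1, Thm 2 p.259, (1.3) p.260, (2.12)–(2.14) p.268, §1 (1.22) p.264, (5.10) p.293; Balaban1988RG2Cluster, Lemma 3 (2.38) p.20; Balaban1989LargeFieldII, Thm 1 p.355; Balaban1988Convergent, (2.6) p.255 (bookkeeping)] -/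
theorem stabilityB_body_of_rung1At_of_remAtE3_of_drift (θ : Stage13HParams F 2) (h : θ.Provisos₁₃SepCoPH F 2) (w : WorldP)
    (hU : θ.ZhUnity F 2 ∧ θ.SlotsNondegenerate₁₃ F 2) (hθ : θ.Admissible F 2)
    (hR : ∃ (θ' : Stage13HParams F 2) (h' : θ'.Provisos₁₃SepCoPH F 2), θ'.Admissible F 2 ∧
      datumOfRecord₁₃SepCoPH F 2 θ h = datumOfRecord₁₃SepCoPH F 2 θ' h' ∧ w.C = (datumOfRecord₁₃SepCoPH F 2 θ h).C ∧ (0 < w.γ ∧ w.γ ≤ θ'.γ) ∧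
      w.L = (θ'.L : ℝ) ∧ ∀ P : B12.RunParams, w.up P = upOfRecord₅CS F 2 (θ'.toStage5₁₃CoPH F 2) P)
    (hnodes : ∀ P : B12.RunParams, Nodes (leavesP w P)) (κ : StepColourData) {c A γ₁ : ℝ}
    (hRem : RemAt F κ θ h c) (hdrift : OneLoopDrift (B12Normalization.stepBal 2 F.L) A (beta0OfJs F κ))
    (hγ₁ : 0 < γ₁) (hhi : BetaUpperH w.βup γ₁ (datumOfRecord₁₃SepCoPH F 2 θ h).βfun) :
    (θ.ZhUnity F 2 ∧ θ.SlotsNondegenerate₁₃ F 2) ∧ θ.Admissible F 2 ∧ B16.EndStatementBPrinted (datumOfRecord₁₃SepCoPH F 2 θ h).C ∧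
      ∃ γ₂ : ℝ, 0 < γ₂ ∧ ∀ γ : ℝ, 0 < γ → γ ≤ γ₂ → ∃ P : B12.RunParams, 1 ≤ P.K ∧ ((datumOfRecord₁₃SepCoPH F 2 θ h).C P).flow.InInterval γ P.K := by
  obtain ⟨γ₀, s, hγ₀, -, -, -, -, -, -, hps, -⟩ := constAnchorPackage_of_remAt_drift F κ θ h hRem hdrift
  exact stabilityB_body_of_rung1At_of_partialSumsH_of_ceiling θ h w hU hθ hR hnodes (lt_min hγ₀ hγ₁)
    (betaPartialSumsLowerH_mono (min_le_left _ _) hps) (fun k v hv => hhi k v (box_mono (min_le_right _ _) k hv))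

/-- **★★★ THE SAME WITH THE CEILING ALSO FROM THE PACKAGE** — the only K1-side letter is the numeric MATCH `c·stepBal 2 F.L + 2|c|A + s ≤ w.βup` for the package's own `s`
(stated as: every ceiling constant the package can produce is at most `w.βup`, i.e. «any box ceiling of the datum's β ⟹ `w.βup` is a ceiling on a sub-box»). [cite: Balaban1987RG1, §1 (1.22) p.264 and (2.12)–(2.14) p.268 (bookkeeping)] -/
theorem stabilityB_body_of_rung1At_of_remAtE3_of_drift_of_ceilingMatch (θ : Stage13HParams F 2) (h : θ.Provisos₁₃SepCoPH F 2) (w : WorldP)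
    (hU : θ.ZhUnity F 2 ∧ θ.SlotsNondegenerate₁₃ F 2) (hθ : θ.Admissible F 2)
    (hR : ∃ (θ' : Stage13HParams F 2) (h' : θ'.Provisos₁₃SepCoPH F 2), θ'.Admissible F 2 ∧
      datumOfRecord₁₃SepCoPH F 2 θ h = datumOfRecord₁₃SepCoPH F 2 θ' h' ∧ w.C = (datumOfRecord₁₃SepCoPH F 2 θ h).C ∧ (0 < w.γ ∧ w.γ ≤ θ'.γ) ∧
      w.L = (θ'.L : ℝ) ∧ ∀ P : B12.RunParams, w.up P = upOfRecord₅CS F 2 (θ'.toStage5₁₃CoPH F 2) P)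
    (hnodes : ∀ P : B12.RunParams, Nodes (leavesP w P)) (κ : StepColourData) {c A : ℝ}
    (hRem : RemAt F κ θ h c) (hdrift : OneLoopDrift (B12Normalization.stepBal 2 F.L) A (beta0OfJs F κ))
    (hceil : ∀ γ₀ β' : ℝ, 0 < γ₀ → BetaUpperH β' γ₀ (datumOfRecord₁₃SepCoPH F 2 θ h).βfun →
      ∃ γ₁ : ℝ, 0 < γ₁ ∧ γ₁ ≤ γ₀ ∧ BetaUpperH w.βup γ₁ (datumOfRecord₁₃SepCoPH F 2 θ h).βfun) :
    (θ.ZhUnity F 2 ∧ θ.SlotsNondegenerate₁₃ F 2) ∧ θ.Admissible F 2 ∧ B16.EndStatementBPrinted (datumOfRecord₁₃SepCoPH F 2 θ h).C ∧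
      ∃ γ₂ : ℝ, 0 < γ₂ ∧ ∀ γ : ℝ, 0 < γ → γ ≤ γ₂ → ∃ P : B12.RunParams, 1 ≤ P.K ∧ ((datumOfRecord₁₃SepCoPH F 2 θ h).C P).flow.InInterval γ P.K := by
  obtain ⟨γ₀, s, hγ₀, -, -, -, -, -, -, -, hup⟩ := constAnchorPackage_of_remAt_drift F κ θ h hRem hdrift
  obtain ⟨γ₁, hγ₁, -, hhi⟩ := hceil γ₀ _ hγ₀ hup
  exact stabilityB_body_of_rung1At_of_remAtE3_of_drift θ h w hU hθ hR hnodes κ hRem hdrift hγ₁ hhi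

end AtTheta

/-! ## §2–§3. ★★★★★ The ROUTE DECL BY NAME from K1⁷'s stub 1 and the edition-3 stub texts (VERBATIM from DEF-1's `EndpointGivenBR13SepCoPH_of_shadowingJets`) -/

section Registered

/-- **★★★★★ K1⁷ BY NAME WITH NO β LETTER ON THE K1 SIDE, EDITION 3**: a CEILING-UNIFORM rung-1 family at one unity tuple («`∀ c′, ∃ w, c′ ≤ w.βup ∧ RecordS θ h w ∧ ∀ P, Nodes (leavesP w P)`»;
plan's `RecordS` spelled out; the rung's `PrintedUV3V` ∕ [IV]-pin conjuncts are not read by the consequent and are omitted) and the ed.3 stub texts — `h₁` (stub 1′: «`RemAt F κ θ hP θ.cβ` ⟹ the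
named numbers drift at the bare slope») and `h₂` (stub 2′: «at every admissible proviso'd record SOME κ shadows it at scale `θ.cβ`»), VERBATIM the hypotheses of DEF-1's
`EndpointGivenBR13SepCoPH_of_shadowingJets` — give `Summit.QuantumFields.YangMills.Theses.BalabanUVNodes.StabilityBAtRecordR13SepCoPH`.  Road: κ from `h₂`; drift from `h₁`; the package's
ceiling constant; a world above it from the family; §1.  So K1⁷ and K2⁷ read the SAME two stub texts; the K1 side adds stub 1 in ceiling-uniform form and nothing else.  CONDITIONAL on the
three displayed hypotheses; (P6) unpinned; K1⁷ ∕ K2⁷ NOT closed; nothing of Bałaban asserted; no count moved.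
[cite: Balaban1989LargeFieldII, Thm 1 p.355 + (0.1) pp.355–356 + p.391; Balaban1987RG1, Thm 2 p.259, (1.3) p.260, (2.12)–(2.14) p.268, §1 (1.22) p.264, (5.10) p.293; Balaban1988RG2Cluster, Lemma 3 (2.38) p.20; Balaban1988Convergent, (2.6) p.255 and Cor. 3 (2.50) p.264 (bookkeeping)] -/
theorem stabilityBAtRecordR13SepCoPH_of_stub1CeilingUniform_of_k2NamedJetsStubsE3
    (h₁K1 : ∀ F : T4Family, (∃ θ : Stage13HParams F 2, θ.Provisos₁₃SepCoPH F 2 ∧ (θ.ZhUnity F 2 ∧ θ.SlotsNondegenerate₁₃ F 2) ∧ θ.Admissible F 2) →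
      ∃ (θ : Stage13HParams F 2) (h : θ.Provisos₁₃SepCoPH F 2), (θ.ZhUnity F 2 ∧ θ.SlotsNondegenerate₁₃ F 2) ∧ θ.Admissible F 2 ∧
        ∀ c' : ℝ, ∃ w : WorldP, c' ≤ w.βup ∧
          (∃ (θ' : Stage13HParams F 2) (h' : θ'.Provisos₁₃SepCoPH F 2), θ'.Admissible F 2 ∧
            datumOfRecord₁₃SepCoPH F 2 θ h = datumOfRecord₁₃SepCoPH F 2 θ' h' ∧ w.C = (datumOfRecord₁₃SepCoPH F 2 θ h).C ∧ (0 < w.γ ∧ w.γ ≤ θ'.γ) ∧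
            w.L = (θ'.L : ℝ) ∧ ∀ P : B12.RunParams, w.up P = upOfRecord₅CS F 2 (θ'.toStage5₁₃CoPH F 2) P) ∧
          (∀ P : B12.RunParams, Nodes (leavesP w P)))
    (h₁ : ∀ (F : T4Family) (κ : StepColourData) (θ : Stage13HParams F 2) (hP : θ.Provisos₁₃SepCoPH F 2), θ.Admissible F 2 →
      RemAt F κ θ hP θ.cβ → ∃ A : ℝ, OneLoopDrift (B12Normalization.stepBal 2 F.L) A (beta0OfJs F κ))
    (h₂ : ∀ (F : T4Family) (θ : Stage13HParams F 2) (hP : θ.Provisos₁₃SepCoPH F 2), θ.Admissible F 2 →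
      ∃ κ : StepColourData, RemAt F κ θ hP θ.cβ) :
    Summit.QuantumFields.YangMills.Theses.BalabanUVNodes.StabilityBAtRecordR13SepCoPH := by
  intro F hinh
  obtain ⟨θ, h, hU, hθ, hfam⟩ := h₁K1 F hinh
  obtain ⟨κ, hRem⟩ := h₂ F θ h hθ
  obtain ⟨A, hdrift⟩ := h₁ F κ θ h hθ hRem
  obtain ⟨γ₀, s, hγ₀, -, -, -, -, -, -, -, hup⟩ := constAnchorPackage_of_remAt_drift F κ θ h hRem hdrift
  obtain ⟨w, hc, hR, hnodes⟩ := hfam (θ.cβ * B12Normalization.stepBal 2 F.L + 2 * (|θ.cβ| * A) + s)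
  exact ⟨θ, h, stabilityB_body_of_rung1At_of_remAtE3_of_drift θ h w hU hθ hR hnodes κ hRem hdrift hγ₀ (fun k v hv => (hup k v hv).trans hc)⟩

/-- **★★★★ THE SAME FROM THE REGISTERED RUNG-1 TEXT (v5, `RecordS` unfolded) PLUS THE CEILING LETTER AT EVERY RUNG-1 WITNESS** (`hceil` = «`∃ γ₁ > 0, BetaUpperH w.βup γ₁ (datum θ h).βfun`»
— [Balaban1987RG1] §1 p.264 «uniformly bounded» read against the witness's own ceiling; the one K1-side letter of the non-uniform form, cf. dag-n12-d's ANSWER-CEILING: it is met e.g.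
by a world built with `w.βup :=` a known box ceiling).  CONDITIONAL; closes nothing. [cite: Balaban1989LargeFieldII, Thm 1 p.355 + (0.1) pp.355–356 + p.391; Balaban1987RG1, Thm 2 p.259, §1 (1.22) p.264; Balaban1988Convergent, (2.6) p.255 (bookkeeping)] -/
theorem stabilityBAtRecordR13SepCoPH_of_stub1_of_k2NamedJetsStubsE3_of_ceiling_at_witness
    (h₁K1 : ∀ F : T4Family, (∃ θ : Stage13HParams F 2, θ.Provisos₁₃SepCoPH F 2 ∧ (θ.ZhUnity F 2 ∧ θ.SlotsNondegenerate₁₃ F 2) ∧ θ.Admissible F 2) →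
      ∃ (θ : Stage13HParams F 2) (h : θ.Provisos₁₃SepCoPH F 2) (w : WorldP), (θ.ZhUnity F 2 ∧ θ.SlotsNondegenerate₁₃ F 2) ∧ θ.Admissible F 2 ∧
        (∃ (θ' : Stage13HParams F 2) (h' : θ'.Provisos₁₃SepCoPH F 2), θ'.Admissible F 2 ∧
          datumOfRecord₁₃SepCoPH F 2 θ h = datumOfRecord₁₃SepCoPH F 2 θ' h' ∧ w.C = (datumOfRecord₁₃SepCoPH F 2 θ h).C ∧ (0 < w.γ ∧ w.γ ≤ θ'.γ) ∧
          w.L = (θ'.L : ℝ) ∧ ∀ P : B12.RunParams, w.up P = upOfRecord₅CS F 2 (θ'.toStage5₁₃CoPH F 2) P) ∧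
        (∀ P : B12.RunParams, Nodes (leavesP w P)) ∧ PrintedUV3V 2 θ.L ∧
        ∃ lam : ResidW F 2, (∀ P : B12.RunParams, 1 ≤ P.K → lam.kSel P < P.K) ∧
          ∀ P : B12.RunParams, lam.kSel P < P.K → ((leavesP w P).rBasicStep ↔ B15Leaf (WOfRecord₁₃ F 2 θ.toStage13Params lam P)))
    (h₁ : ∀ (F : T4Family) (κ : StepColourData) (θ : Stage13HParams F 2) (hP : θ.Provisos₁₃SepCoPH F 2), θ.Admissible F 2 →
      RemAt F κ θ hP θ.cβ → ∃ A : ℝ, OneLoopDrift (B12Normalization.stepBal 2 F.L) A (beta0OfJs F κ))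
    (h₂ : ∀ (F : T4Family) (θ : Stage13HParams F 2) (hP : θ.Provisos₁₃SepCoPH F 2), θ.Admissible F 2 →
      ∃ κ : StepColourData, RemAt F κ θ hP θ.cβ)
    (hceil : ∀ (F : T4Family) (θ : Stage13HParams F 2) (h : θ.Provisos₁₃SepCoPH F 2) (w : WorldP),
      (θ.ZhUnity F 2 ∧ θ.SlotsNondegenerate₁₃ F 2) → θ.Admissible F 2 →
      (∃ (θ' : Stage13HParams F 2) (h' : θ'.Provisos₁₃SepCoPH F 2), θ'.Admissible F 2 ∧
        datumOfRecord₁₃SepCoPH F 2 θ h = datumOfRecord₁₃SepCoPH F 2 θ' h' ∧ w.C = (datumOfRecord₁₃SepCoPH F 2 θ h).C ∧ (0 < w.γ ∧ w.γ ≤ θ'.γ) ∧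
        w.L = (θ'.L : ℝ) ∧ ∀ P : B12.RunParams, w.up P = upOfRecord₅CS F 2 (θ'.toStage5₁₃CoPH F 2) P) →
      (∀ P : B12.RunParams, Nodes (leavesP w P)) →
      ∃ γ₁ : ℝ, 0 < γ₁ ∧ BetaUpperH w.βup γ₁ (datumOfRecord₁₃SepCoPH F 2 θ h).βfun) :
    Summit.QuantumFields.YangMills.Theses.BalabanUVNodes.StabilityBAtRecordR13SepCoPH := by
  intro F hinh
  obtain ⟨θ, h, w, hU, hθ, hR, hnodes, -, -⟩ := h₁K1 F hinh
  obtain ⟨κ, hRem⟩ := h₂ F θ h hθ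
  obtain ⟨A, hdrift⟩ := h₁ F κ θ h hθ hRem
  obtain ⟨γ₁, hγ₁, hhi⟩ := hceil F θ h w hU hθ hR hnodes
  exact ⟨θ, h, stabilityB_body_of_rung1At_of_remAtE3_of_drift θ h w hU hθ hR hnodes κ hRem hdrift hγ₁ hhi⟩

end Registered

end Summit.QuantumFields.YangMills.BalabanUVNodes.K1EndOfNodes13PWSOfK2NamedJetsE3

end
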